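import Summits.ABC.IUTFork.Cor312LicenceWildExactCellIff
import HarnessLib

/-!
# [IUTchIII] Cor. 3.12 — the (xi-f) licence / branch C's antecedent for REALISING pilot ideles at fibres of ARBITRARY local type,
# as ONE predicate in the q-degrees `P_q(w)`, the ramification indices, the differents and the inner/outer shell radii

PROOF-ONLY file (D-0012; 0 definitions, 0 `Prop` facts) of the abc-iut cell — D-0079 RESCUE sub-cell R-W «WINDOW Θ-SIDE INEQUALITY», lane U,
row «U2-LICENCE-WRAPPER» (ruling C-R30 2026-08-26T14:20:36Z), seat abc-iut-w4-d036 gen 7; part 3 over `Cor312LicenceWildExactCells` /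
`…CellIff`. TAKES NO SIDE on [IUTchIII] Cor. 3.12 (S. Mochizuki, *Inter-universal Teichmüller theory III*, kurims manuscript, Cor. 3.12 p. 173
l. 41 – p. 174 l. 19; Step (xi-f) p. 184 l. 26–29) or on any author: statements about OUR typed objects (abc-iut-c312-7's `settingPrVolSharp`,
abc-iut-c312-5's `presAt` and typed (Ind1)(Ind2), branch C's `QPinned ∧ PilotKummerCompatHull`); the hull-level licence is a STRONGER-THAN-PRINT
reading of Step (xi-f); nothing here bears on the printed GLOBAL inequality or the number-level corollary; the existence of initial Θ-data
realising the hypotheses is NOT claimed. typed ≠ proved; instantiated ≠ endorsed.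

WHAT IS PROVED (namespace `Summit.ABC.IUTFork.Thm311.Real`; realising ideles `ht0`/`ht`/`htq` — Dupuy–Hilado (3.4) through abc-iut-w5-d236's
`norm_thetaIdele_eq_rpow_of_realises` / `norm_qIdele_eq_rpow_of_realises`: `‖t_{Θ,i+1,w}‖ = p^{−(i+1)²·P_q(w)/e_w}`, `‖t_{q,w}‖ = p^{−P_q(w)/e_w}`;
per prime `p` and place `x | p` inner/outer shell radii `cin p x` / `cout p x` in abc-iut-c312-5's binder convention, see part 2):
* **`licence_settingPrVolSharp_iff_shellRadii_of_realises`** — `Licence ⟺ ∀ p i v⃗, ∃ σ, ∀ m,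
  (∀ J, p^m·p^{−(i+1)²P_q(v_{σ(last)})/e(v_{σ(last)})} ≤ p^{−(d_I − d_{L_J})}·∏_a ‖cin v_a‖) → p^m·p^{−P_q(v_{last})/e(v_{last})} ≤ ∏_a ‖cout v_a‖`;
* **`exists_qPinned_and_hull_settingPrVolSharp_iff_shellRadii_of_realises`** — branch C's «∃ ρ qK, QPinned ∧ PilotKummerCompatHull» ⟺ the same
  (any columns `col`).
These are the wild generalisations of abc-iut-w5-d009's `licence_settingPrVolSharp_iff_of_realises_tame` /
`exists_qPinned_and_hull_settingPrVolSharp_iff_of_realises_tame` (p448597: there `‖cin‖ = ‖cout‖ = ‖ϖ‖`, and the predicate collapses to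
`e·((j²P_w − 1) div e) + 1 − j(e−1) ≤ P_w`). READING (neutral; numbers, not adjectives): a WINDOW-TABLE row (datum, `p`, label, tuple) is decided in
OUR typing by `(e(x|p), d_x, r_in(x), r_out(x))_{x|p}` and `P_q`; at the GENUINE datum `Cor312Prov.pilotDataOfK` the q-degrees are integral
(abc-iut-w5-d009 `exists_nat_qPilot_pilotDataOfK`) — that instantiation is the p449282 pattern and is left to the consumer. HONEST SCOPE as in
parts 1–2. [cite: Mochizuki2012, IUTchIII Cor. 3.12 p. 173–175, Step (xi) (xi-d)(xi-f) p. 183–184; IUTchIV Prop. 1.1 p. 9, Prop. 1.2 (i)(ii)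
p. 10] [cite: DupuyHilado2025, §3.3, §3.4, §3.9, §4.9, §4.12] [claim: Mochizuki2012, status: disputed] for every IUT sentence quoted.
-/

noncomputable section

open Set Function
open scoped Pointwise TensorProduct

/-! ## §5. REALISING ideles: the predicate in the q-degrees `P_q(w)` and the ramification indices -/

namespace Summit.ABC.IUTFork.Thm311.Real

open Cor312 Cor312.Setting Cor312Vol Cor312Vol.ExplicitDepth Literature.IUT.LogThetaLattice Literature.IUT.LogVolume NumberField
  IsDedekindDomain
open Literature.NumberTheory.NumberFields Literature.NumberTheory.GaloisRepresentations.Ultrametric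

variable {F : Type} [Field F] [NumberField F] (X : PilotData F) {logv : PadicLogs F} (hlog : LogvAnalytic logv)
  (M : Type) [Field M] [NumberField M]
  (archPk : ∀ (j : (thetaIndex X).Label) (vQ : (thetaIndex X).VQ), Set ((logShellsDH X logv).Packet j vQ))
  (archSub : ∀ (j : (thetaIndex X).Label) (v : (thetaIndex X).V),
    Set ((logShellsDH X logv).Packet j ((thetaIndex X).over v)))
  (Ψ : ℤ → ∀ v : (thetaIndex X).V, v ∈ (thetaIndex X).Vbad → Set ((logShellsDH X logv).StarPacket v))
  (act : ℤ → ∀ v : (thetaIndex X).V, v ∈ (thetaIndex X).Vbad →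
    (logShellsDH X logv).StarPacket v → Module.End ℚ ((logShellsDH X logv).StarPacket v))
  (Mmod : ℤ → ∀ j : (thetaIndex X).LabelStar, Set ((logShellsDH X logv).GlobalPacket j.1))
  (region : ℤ → ∀ j : (thetaIndex X).LabelStar, FinDivisor M → ∀ vQ : (thetaIndex X).VQ,
    Set ((logShellsDH X logv).Packet j.1 vQ))
  (n : ℤ) {HT : Type} {LogLink : HT → HT → Type} {IsFull : ∀ {s t : HT}, LogLink s t → Prop}
  (lat : LGPGaussianLogThetaLattice LogLink IsFull)
  {Frd : Type} {IsoF : Frd → Frd → Type} {Ob : Frd → Type} {realify : Frd → Frd} {Strip : Type}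
  {IsoS : Strip → Strip → Type} {Mv : ∀ v : (thetaIndex X).V, v ∈ (thetaIndex X).Vbad → Type}
  [∀ v h, Monoid (Mv v h)]
  (sig : GlobalLGPFrobenioidSignature (thetaIndex X).lstar (thetaIndex X).V (· ∈ (thetaIndex X).Vbad)
    Frd IsoF Ob realify Strip IsoS Mv)
  (split : SplittingMonoids Mv) {ObΔ : Type} {N : ∀ v : (thetaIndex X).V, v ∈ (thetaIndex X).Vbad → Type}
  [∀ v h, Monoid (N v h)] (qData : QPilotData ObΔ N)
  (tq : ∀ (pp : Nat.Primes) (x : (thetaIndex X).Fibre (.inr pp)), haveI : Fact (pp : ℕ).Prime := ⟨pp.2⟩; kOf X pp.1 x)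
  (t : ∀ (pp : Nat.Primes) (_ : Fin X.lstar) (x : (thetaIndex X).Fibre (.inr pp)),
    haveI : Fact (pp : ℕ).Prime := ⟨pp.2⟩; kOf X pp.1 x)
  (htq0 : ∀ pp x, tq pp x ≠ 0)
  (htq1 : ∀ (pp : Nat.Primes) (x : (thetaIndex X).Fibre (.inr pp)),
    haveI : Fact (pp : ℕ).Prime := ⟨pp.2⟩; placeOf X pp.1 x ∉ X.S → ‖tq pp x‖ = 1)
  (col : ℤ → Column (logShellsDH X logv))
  (ht0 : ∀ pp i x, t pp i x ≠ 0)
  (ht : ∀ (pp : Nat.Primes) (i : Fin X.lstar) (x : (thetaIndex X).Fibre (.inr pp)),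
    haveI : Fact (pp : ℕ).Prime := ⟨pp.2⟩
    Real.log ‖t pp i x‖ = -(X.thetaPilot i (placeOf X pp.1 x)) * logNorm F (placeOf X pp.1 x) /
      localDegree F (placeOf X pp.1 x))
  (htq : ∀ (pp : Nat.Primes) (x : (thetaIndex X).Fibre (.inr pp)),
    haveI : Fact (pp : ℕ).Prime := ⟨pp.2⟩
    Real.log ‖tq pp x‖ = -(X.qPilot (placeOf X pp.1 x)) * logNorm F (placeOf X pp.1 x) /
      localDegree F (placeOf X pp.1 x))

include ht0 ht htq in
/-- **THE (xi-f) LICENCE AT `settingPrVolSharp` FOR REALISING IDELES, ANY LOCAL TYPE.** Θ- and q-ideles realising the pilot divisors of `X`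
(Dupuy–Hilado (3.4): `‖t_{Θ,i+1,w}‖ = p^{−(i+1)²·P_q(w)/e_w}`, `‖t_{q,w}‖ = p^{−P_q(w)/e_w}`, abc-iut-w5-d236's `norm_thetaIdele_eq_rpow_of_realises` /
`norm_qIdele_eq_rpow_of_realises`); per prime `p` and place `x | p` the inner/outer shell radii `cin p x`, `cout p x` of part 2. THEN
abc-iut-c312-1's `Thm311ToCor312.Licence` holds **iff** for every `p`, every label `i+1` and every summand `v⃗` SOME slot `σ(last)` satisfies
`∀ m, (∀ J, p^m·p^{−(i+1)²P_q(v_{σ(last)})/e(v_{σ(last)})} ≤ p^{−(d_I − d_{L_J})}·∏_a ‖cin v_a‖) → p^m·p^{−P_q(v_{last})/e(v_{last})} ≤ ∏_a ‖cout v_a‖`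
— the wild generalisation of abc-iut-w5-d009's `licence_settingPrVolSharp_iff_of_realises_tame`. [cite: DupuyHilado2025, §3.3, §3.4, §3.9, §4.9, §4.12]
[cite: Mochizuki2012, IUTchIII Cor. 3.12 Step (xi-f) p. 184; IUTchIV Prop. 1.1 p. 9, Prop. 1.2 (i)(ii) p. 10] [claim: Mochizuki2012, status: disputed] -/
theorem licence_settingPrVolSharp_iff_shellRadii_of_realises
    (cin cout : ∀ (pp : Nat.Primes) (x : (thetaIndex X).Fibre (.inr pp)),
      haveI : Fact (pp : ℕ).Prime := ⟨pp.2⟩; (presAt X hlog pp).k x)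
    (hin0 : ∀ pp x, cin pp x ≠ 0)
    (hin : ∀ (pp : Nat.Primes) (x : (thetaIndex X).Fibre (.inr pp)), haveI : Fact (pp : ℕ).Prime := ⟨pp.2⟩;
      ∀ o : (presAt X hlog pp).k x, ‖o‖ ≤ 1 → cin pp x * o ∈ logUnits ((presAt X hlog pp).k x))
    (hmax : ∀ (pp : Nat.Primes) (x : (thetaIndex X).Fibre (.inr pp)), haveI : Fact (pp : ℕ).Prime := ⟨pp.2⟩;
      ∃ (ϖ : ((presAt X hlog pp).k x)ˣ) (w : (presAt X hlog pp).k x),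
        IsUniformizer ϖ ∧ w ∉ logUnits ((presAt X hlog pp).k x) ∧ ‖w‖ * ‖(ϖ : (presAt X hlog pp).k x)‖ ≤ ‖cin pp x‖)
    (hout0 : ∀ pp x, cout pp x ≠ 0)
    (houtΛ : ∀ (pp : Nat.Primes) (x : (thetaIndex X).Fibre (.inr pp)), haveI : Fact (pp : ℕ).Prime := ⟨pp.2⟩;
      cout pp x ∈ logUnits ((presAt X hlog pp).k x))
    (hdom : ∀ (pp : Nat.Primes) (x : (thetaIndex X).Fibre (.inr pp)), haveI : Fact (pp : ℕ).Prime := ⟨pp.2⟩;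
      ∀ z ∈ logUnits ((presAt X hlog pp).k x), ‖z‖ ≤ ‖cout pp x‖) :
    Thm311ToCor312.Licence (settingPrVolSharp X hlog M archPk archSub Ψ act Mmod region n lat sig split qData tq t htq0 htq1) ↔
      ∀ (pp : Nat.Primes) (i : Fin (thetaIndex X).lstar)
        (e : (thetaIndex X).Caps (Setting.labelSucc i) → (thetaIndex X).Fibre (.inr pp)),
        haveI : Fact (pp : ℕ).Prime := ⟨pp.2⟩
        ∃ σ : Equiv.Perm ((thetaIndex X).Caps (Setting.labelSucc i)), ∀ m : ℤ,
          (∀ J : DIdx (pp : ℕ) ((presAt X hlog pp).kk e),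
              ((pp : ℕ) : ℝ) ^ m * ((pp : ℕ) : ℝ) ^ (-((((i : ℕ) + 1 : ℕ) : ℝ) ^ 2 * X.qPilot (placeOf X pp.1 (e (σ (Fin.last _))))) /
                  (ramIdx F (placeOf X pp.1 (e (σ (Fin.last _)))) : ℝ)) ≤
                ((pp : ℕ) : ℝ) ^ (-(dSum (pp : ℕ) ((presAt X hlog pp).kk e) -
                  differentOrd (pp : ℕ) (DFac (pp : ℕ) ((presAt X hlog pp).kk e) J))) * ∏ a, ‖cin pp (e a)‖) →
            ((pp : ℕ) : ℝ) ^ m * ((pp : ℕ) : ℝ) ^ (-(X.qPilot (placeOf X pp.1 (e (Fin.last _)))) /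
                (ramIdx F (placeOf X pp.1 (e (Fin.last _))) : ℝ)) ≤ ∏ a, ‖cout pp (e a)‖ := by
  rw [licence_settingPrVolSharp_iff_shellRadii X hlog M archPk archSub Ψ act Mmod region n lat sig split qData tq t htq0 htq1 ht0 cin cout
    hin0 hin hmax hout0 houtΛ hdom]
  simp only [norm_thetaIdele_eq_rpow_of_realises X tq t htq0 ht0 ht htq, norm_qIdele_eq_rpow_of_realises X tq htq0 htq]

include ht0 ht htq in
/-- **BRANCH C's PER-DATUM ANTECEDENT FOR REALISING IDELES, ANY LOCAL TYPE** (any columns `col`; realising q-ideles have norm `≤ 1`,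
`norm_qIdele_le_one_of_realises`): «∃ ρ qK, QPinned ∧ PilotKummerCompatHull» at `settingPrVolSharp` ⟺ the displayed predicate — the wild
generalisation of abc-iut-w5-d009's `exists_qPinned_and_hull_settingPrVolSharp_iff_of_realises_tame`; the decided-U2 test of the R-W
WINDOW-TABLE at the level of the certificates' `hSHw`-shaped binder. [cite: DupuyHilado2025, §3.3, §3.4, §3.9, §4.9, §4.12]
[cite: Mochizuki2012, IUTchIII Cor. 3.12 Step (xi-d) p. 183, (xi-f) p. 184] [claim: Mochizuki2012, status: disputed] -/
theorem exists_qPinned_and_hull_settingPrVolSharp_iff_shellRadii_of_realises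
    (cin cout : ∀ (pp : Nat.Primes) (x : (thetaIndex X).Fibre (.inr pp)),
      haveI : Fact (pp : ℕ).Prime := ⟨pp.2⟩; (presAt X hlog pp).k x)
    (hin0 : ∀ pp x, cin pp x ≠ 0)
    (hin : ∀ (pp : Nat.Primes) (x : (thetaIndex X).Fibre (.inr pp)), haveI : Fact (pp : ℕ).Prime := ⟨pp.2⟩;
      ∀ o : (presAt X hlog pp).k x, ‖o‖ ≤ 1 → cin pp x * o ∈ logUnits ((presAt X hlog pp).k x))
    (hmax : ∀ (pp : Nat.Primes) (x : (thetaIndex X).Fibre (.inr pp)), haveI : Fact (pp : ℕ).Prime := ⟨pp.2⟩;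
      ∃ (ϖ : ((presAt X hlog pp).k x)ˣ) (w : (presAt X hlog pp).k x),
        IsUniformizer ϖ ∧ w ∉ logUnits ((presAt X hlog pp).k x) ∧ ‖w‖ * ‖(ϖ : (presAt X hlog pp).k x)‖ ≤ ‖cin pp x‖)
    (hout0 : ∀ pp x, cout pp x ≠ 0)
    (houtΛ : ∀ (pp : Nat.Primes) (x : (thetaIndex X).Fibre (.inr pp)), haveI : Fact (pp : ℕ).Prime := ⟨pp.2⟩;
      cout pp x ∈ logUnits ((presAt X hlog pp).k x))
    (hdom : ∀ (pp : Nat.Primes) (x : (thetaIndex X).Fibre (.inr pp)), haveI : Fact (pp : ℕ).Prime := ⟨pp.2⟩;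
      ∀ z ∈ logUnits ((presAt X hlog pp).k x), ‖z‖ ≤ ‖cout pp x‖) :
    (∃ (ρ : (∀ v : (thetaIndex X).V, v ∈ (thetaIndex X).Vbad → Set ((logShellsDH X logv).StarPacket v)) →
          ∀ (j : (thetaIndex X).Label) (vQ : (thetaIndex X).VQ), Set ((logShellsDH X logv).Packet j vQ))
        (qK : ∀ v : (thetaIndex X).V, v ∈ (thetaIndex X).Vbad → Set ((logShellsDH X logv).StarPacket v)),
        QPinned ({ toSituation := situationPrVol X hlog M archPk archSub Ψ act Mmod region, col := col } :
            LatticeSituation (thetaIndex X))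
          (settingPrVolSharp X hlog M archPk archSub Ψ act Mmod region n lat sig split qData tq t htq0 htq1) ρ qK ∧
        PilotKummerCompatHull ({ toSituation := situationPrVol X hlog M archPk archSub Ψ act Mmod region, col := col } :
            LatticeSituation (thetaIndex X))
          (settingPrVolSharp X hlog M archPk archSub Ψ act Mmod region n lat sig split qData tq t htq0 htq1) ρ qK) ↔
      ∀ (pp : Nat.Primes) (i : Fin (thetaIndex X).lstar)
        (e : (thetaIndex X).Caps (Setting.labelSucc i) → (thetaIndex X).Fibre (.inr pp)),
        haveI : Fact (pp : ℕ).Prime := ⟨pp.2⟩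
        ∃ σ : Equiv.Perm ((thetaIndex X).Caps (Setting.labelSucc i)), ∀ m : ℤ,
          (∀ J : DIdx (pp : ℕ) ((presAt X hlog pp).kk e),
              ((pp : ℕ) : ℝ) ^ m * ((pp : ℕ) : ℝ) ^ (-((((i : ℕ) + 1 : ℕ) : ℝ) ^ 2 * X.qPilot (placeOf X pp.1 (e (σ (Fin.last _))))) /
                  (ramIdx F (placeOf X pp.1 (e (σ (Fin.last _)))) : ℝ)) ≤
                ((pp : ℕ) : ℝ) ^ (-(dSum (pp : ℕ) ((presAt X hlog pp).kk e) -
                  differentOrd (pp : ℕ) (DFac (pp : ℕ) ((presAt X hlog pp).kk e) J))) * ∏ a, ‖cin pp (e a)‖) →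
            ((pp : ℕ) : ℝ) ^ m * ((pp : ℕ) : ℝ) ^ (-(X.qPilot (placeOf X pp.1 (e (Fin.last _)))) /
                (ramIdx F (placeOf X pp.1 (e (Fin.last _))) : ℝ)) ≤ ∏ a, ‖cout pp (e a)‖ := by
  rw [exists_qPinned_and_hull_settingPrVolSharp_iff_licence X hlog M archPk archSub Ψ act Mmod region n lat sig split qData tq t htq0
    htq1 col (fun pp x => norm_qIdele_le_one_of_realises X tq htq0 htq pp x)]
  exact licence_settingPrVolSharp_iff_shellRadii_of_realises X hlog M archPk archSub Ψ act Mmod region n lat sig split qData tq t htq0 htq1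
    ht0 ht htq cin cout hin0 hin hmax hout0 houtΛ hdom

end Summit.ABC.IUTFork.Thm311.Real

end
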